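/-
Copyright (c) 2026 the pub-hodgecm-mathlib formalisation cell (harness21).  Prover seat hodgecm-mathlib-K2E3-p14 (g7), Track B «K2-LIT» ∕ h413
(`stmt-HodgeConjecture-24833`), line `K2_E3_EllipticInputs`, leaf (nsc-S-A′), brick (E4b) = discharge of `h3cell` of ★ E4a, part (E4b-1α).  2026-09-04.
-/
import Literature.NumberTheory.Automorphic.InducedWhittakerVanishing            -- ★ `vanishingOn` (functions of `Ind_H^G σ` vanishing on a set)
import Literature.NumberTheory.Automorphic.UnipotentRadicalCompactOpenProofs     -- ★ `unipotentRadicalGL_le_upperUnitriangular`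
import Literature.NumberTheory.Automorphic.ParabolicIndGLSphericalUnramified     -- ★ `standardParabolicGL_id_le_of_monotone`
import Literature.NumberTheory.Automorphic.ParabolicSemidirect                   -- ★ `continuous_blockDiagonalGL`
import Literature.NumberTheory.Automorphic.ParabolicInductionProofs              -- ★ `rootDeltaChar_eq_one_of_mem_unipotentRadicalP`
import Summits.HodgeConjecture.HodgeConjecture.Theorems.K2E3GL3MaximalParabolicRelabel    -- ★ (K2E3-p03) `mem_standardParabolicGL_iff_entry` for `P_{![0,0,1]}`, `monotone_twoOne`
import HarnessLib

/-!
# K2_E3 road (h413), leaf (nsc-S-A′), brick (E4b-1α) — the `(B, P_c)` filtration of `r_c(Ind_B^{GL_n} σ′)` and its CLOSED CELL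

Cell `pub/hodgecm-mathlib` (D-0151), Track B, seat K2E3-p14 (g7); architect K2E3-p25 (g2) (K2 bus 2026-09-04 11:51:18Z «E4b = discharge of `h3cell`»;
architecture «NCQ dévissage» 12:00:25Z).  `--supports stmt-HodgeConjecture-24833 --as helper`; THEOREMS ONLY (no definition ∕ instance ∕ notation ∕ named fact ∕
`sorry`); never imports `Cruxes/…/Lines`.  COUNT-NEUTRAL; generic `n`, generic monotone block labelling `c`.

THE MATHEMATICS ([BernsteinZelevinsky1977, §2.3, Thm. 5.2 (geometric lemma, closed orbit)]; [Casselman1995, §6.3, Prop. 6.3.1]).  `G = GL_n(F)`, `B = P_{id}` the upper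
Borel, `σ′` a one-dimensional representation of `B` TRIVIAL ON `U = U_n`, `I = Ind_B^G σ′` (★ `smoothIndRep`), `P = P_c ⊇ B` a standard parabolic (`c` monotone) with
Levi `M_c = Π_a GL_{n_a}` (★ block diagonal embedding `diag = blockDiagonalGL F c`) and unipotent radical `U_c ≤ U`, `J = r_c(I)` the (unnormalised) Jacquet module
(★ `jacquetGL F c I`, classes `[f]`).
* §1 **The filtration.**  For a right `P`-stable set `Z ⊆ G` the functions vanishing on `Z` (★ `vanishingOn B σ′ Z`) form a `P`-stable subspace of `I`, so their
  classes form an `M_c`-SUBREPRESENTATION `J_Z ≤ J` (`exists_subrepresentation_jacquetGL_vanishingOn`, ∃-form with the membership `x ∈ J_Z ↔ ∃ f, f|_Z = 0 ∧ [f] = x`);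
  `Z ⊆ Z′ ⇒ J_{Z′} ≤ J_Z`.  (For `GL₃`, `c = ![0,0,1]`: `Z = P` and `Z = P ∪ B s₂ P = {g ∣ g₁₀g₂₁ = g₁₁g₂₀}` give `J ⊇ J₁ ⊇ J₂`, parts (E4b-1β∕γ).)
* §2 **The closed cell `C₀ = B·P = P`.**  Restriction to the Levi, `Ψ₀[f] = (m ↦ f(diag m))`, is a well-defined (`σ′|_{U_c} = 1`) `M_c`-equivariant linear map
  `J → Ind_{B ∩ M_c}^{M_c}(σ′ ∘ diag)` (★ `SmoothInd` of the pulled-back Borel `B.comap diag`), whose KERNEL IS EXACTLY `J_P` (`p = u · diag(levi p)`, `u ∈ U_c`):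
  **`exists_closedCellMap`**.  No measure, no topology beyond smoothness.
Consumer: (E4b-3) `K2E3GL3WeakCellLemma` (with (E4b-2■) «relative NCQ for induced-from-`⊇U`» on the target and (E4b-1β∕γ) on `J₁ ∕ J₂`).

HONEST LABEL: HC_CM is proved only modulo the 7 printed citations (2 remaining named inputs: hLiu418 = stmt-HodgeConjecture-24832, h413 = stmt-HodgeConjecture-24833)
until rung 0 closes; count-neutral helper.

## Mathlib ∕ tree search
★ `vanishingOn`∕`mem_vanishingOn_iff` (InducedWhittakerVanishing), ★ `jacquetGL_mk`, ★ `blockDiagonalGL_mem`, ★ `coe_leviEmbeddingP`, ★ `leviProjection_leviEmbeddingP_apply`,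
★ `unipotentRadicalP = ker leviProjection` (abbrev), ★ `unipotentRadicalGL_subgroupOf`, ★ `unipotentRadicalGL_le_upperUnitriangular`, ★ `standardParabolicGL_id_le_of_monotone`,
★ `continuous_blockDiagonalGL`, ★ `rootDeltaChar_eq_one_of_mem_unipotentRadicalP`, ★ (K2E3-p03) `mem_standardParabolicGL_iff_entry`, ★ `SmoothInd.toFun_subgroup_mul`, ★ `isSmooth_smoothInd`, ★ `Representation.isSmoothVector_of_le`; Mathlib `Representation.Coinvariants.lift ∕ mk ∕
mk_eq_zero ∕ induction_on`, `Subrepresentation` (SetLike), `MonoidHom.subgroupComap`.  Dedup: `rg "closedCellMap|jacquetGL_vanishingOn"` — no hits.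

## References
* [BernsteinZelevinsky1977] I. N. Bernstein, A. V. Zelevinsky, *Induced representations of reductive p-adic groups I*, Ann. Sci. ÉNS 10 (1977), §2.3, Thm. 5.2.
* [Casselman1995] W. Casselman, *Introduction to the theory of admissible representations of p-adic reductive groups* (draft 1995), §6.3, Prop. 6.3.1.
-/

set_option autoImplicit false
set_option linter.dupNamespace false

noncomputable section

open Function Representation
open scoped MatrixGroups

namespace Summit.HodgeConjecture.HodgeConjecture.Cruxes.H413.K2E3GL3BorelInducedJacquetQFiltration

open Literature.NumberTheory.Automorphic

variable {F : Type} [Field F] [ValuativeRel F] [TopologicalSpace F] [IsNonarchimedeanLocalField F] {n : ℕ}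
  {α : Type*} [LinearOrder α] [Fintype α] (c : Fin n → α)
  (σ' : Representation ℂ ↥(standardParabolicGL F (id : Fin n → Fin n)) ℂ)

/-! ## §1 The `(B, P_c)` filtration: classes of functions vanishing on a right `P_c`-stable set -/

omit [Fintype α] in
/-- Right `P_c`-stability of `vanishingOn B σ′ Z` for a right `P_c`-stable `Z`: `(p·f)(z) = f(z p) = 0`. [cite: BernsteinZelevinsky1977, Thm. 5.2] -/
theorem smoothIndRep_mem_vanishingOn_of_mul_mem (Z : Set (GL (Fin n) F)) (hZ : ∀ z ∈ Z, ∀ p ∈ standardParabolicGL F c, z * p ∈ Z)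
    {p : GL (Fin n) F} (hp : p ∈ standardParabolicGL F c) {f : SmoothInd (standardParabolicGL F (id : Fin n → Fin n)) σ'}
    (hf : f ∈ vanishingOn (standardParabolicGL F (id : Fin n → Fin n)) σ' Z) :
    smoothIndRep (standardParabolicGL F (id : Fin n → Fin n)) σ' p f ∈ vanishingOn (standardParabolicGL F (id : Fin n → Fin n)) σ' Z := by
  intro z hz
  rw [toFun_smoothIndRep_apply]
  exact hf _ (hZ z hz p hp)

/-- **The subrepresentation `J_Z ≤ r_c(Ind_B σ′)` of classes of functions vanishing on a right `P_c`-stable set `Z`** (an `M_c`-subrepresentation: `m·[f] = [diag(m)·f]` and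
`diag(m) ∈ P_c`), characterised by membership. [cite: BernsteinZelevinsky1977, §2.3, Thm. 5.2] [cite: Casselman1995, §6.3] -/
theorem exists_subrepresentation_jacquetGL_vanishingOn (Z : Set (GL (Fin n) F)) (hZ : ∀ z ∈ Z, ∀ p ∈ standardParabolicGL F c, z * p ∈ Z) :
    ∃ J : Subrepresentation (jacquetGL F c (smoothIndRep (standardParabolicGL F (id : Fin n → Fin n)) σ')),
      ∀ x, x ∈ J ↔ ∃ f ∈ vanishingOn (standardParabolicGL F (id : Fin n → Fin n)) σ' Z,
        Coinvariants.mk (restrictUnipotentGL F c (smoothIndRep (standardParabolicGL F (id : Fin n → Fin n)) σ')) f = x := by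
  refine ⟨⟨(vanishingOn (standardParabolicGL F (id : Fin n → Fin n)) σ' Z).map
      (Coinvariants.mk (restrictUnipotentGL F c (smoothIndRep (standardParabolicGL F (id : Fin n → Fin n)) σ'))), fun m x hx => ?_⟩, fun x => Submodule.mem_map⟩
  obtain ⟨f, hf, rfl⟩ := Submodule.mem_map.1 hx
  rw [jacquetGL_mk]
  exact Submodule.mem_map.2 ⟨_, smoothIndRep_mem_vanishingOn_of_mul_mem c σ' Z hZ (blockDiagonalGL_mem c m) hf, rfl⟩

/-- Monotonicity of the filtration: `Z ⊆ Z′` gives `J_{Z′} ≤ J_Z` (for any subrepresentations with the two membership characterisations). [folklore] -/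
theorem subrepresentation_vanishingOn_antitone {Z Z' : Set (GL (Fin n) F)} (hZZ' : Z ⊆ Z')
    {J J' : Subrepresentation (jacquetGL F c (smoothIndRep (standardParabolicGL F (id : Fin n → Fin n)) σ'))}
    (hJ : ∀ x, x ∈ J ↔ ∃ f ∈ vanishingOn (standardParabolicGL F (id : Fin n → Fin n)) σ' Z,
        Coinvariants.mk (restrictUnipotentGL F c (smoothIndRep (standardParabolicGL F (id : Fin n → Fin n)) σ')) f = x)
    (hJ' : ∀ x, x ∈ J' ↔ ∃ f ∈ vanishingOn (standardParabolicGL F (id : Fin n → Fin n)) σ' Z',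
        Coinvariants.mk (restrictUnipotentGL F c (smoothIndRep (standardParabolicGL F (id : Fin n → Fin n)) σ')) f = x) :
    J' ≤ J := by
  intro x hx
  obtain ⟨f, hf, rfl⟩ := (hJ' x).1 hx
  exact (hJ _).2 ⟨f, fun z hz => hf z (hZZ' hz), rfl⟩

/-- The whole Jacquet module is `J_∅`. [folklore] -/
theorem mem_of_vanishingOn_empty {J : Subrepresentation (jacquetGL F c (smoothIndRep (standardParabolicGL F (id : Fin n → Fin n)) σ'))}
    (hJ : ∀ x, x ∈ J ↔ ∃ f ∈ vanishingOn (standardParabolicGL F (id : Fin n → Fin n)) σ' (∅ : Set (GL (Fin n) F)),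
        Coinvariants.mk (restrictUnipotentGL F c (smoothIndRep (standardParabolicGL F (id : Fin n → Fin n)) σ')) f = x)
    (x : (restrictUnipotentGL F c (smoothIndRep (standardParabolicGL F (id : Fin n → Fin n)) σ')).Coinvariants) : x ∈ J := by
  obtain ⟨f, rfl⟩ := Coinvariants.mk_surjective _ x
  exact (hJ _).2 ⟨f, fun z hz => absurd hz (Set.notMem_empty z), rfl⟩

/-! ## §2 The closed cell: restriction to the Levi `Ψ₀[f] = f ∘ diag`, with kernel `J_{P_c}` -/

section ClosedCell

variable (hc : Monotone c)
  (hσ'U : ∀ (u : GL (Fin n) F) (hu : u ∈ upperUnitriangular (Fin n) F), σ' ⟨u, unipotentRadicalGL_le F (id : Fin n → Fin n) hu⟩ = 1)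

include hc hσ'U in
/-- **Values on `P_c` are determined by values on the Levi**: `f(u · diag m) = f(diag m)` for `u ∈ U_c` — precisely, for `p ∈ P_c`,
`f(p) = f(u⁻¹ p)` with `u = p · diag(levi p)⁻¹ ∈ U_c`, i.e. `f(p) = σ′(u) f(diag(levi p)) = f(diag(levi p))`. [cite: BernsteinZelevinsky1977, §2.1, §2.3] -/
theorem toFun_parabolic_eq_toFun_blockDiagonalGL (f : SmoothInd (standardParabolicGL F (id : Fin n → Fin n)) σ') (p : ↥(standardParabolicGL F c)) :
    f.toFun (p : GL (Fin n) F) = f.toFun (blockDiagonalGL F c (leviProjection F c p)) := by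
  -- `u := p · diag(levi p)⁻¹ ∈ U_c ≤ U ≤ B`
  have hu : (p : GL (Fin n) F) * (blockDiagonalGL F c (leviProjection F c p))⁻¹ ∈ unipotentRadicalGL F c := by
    refine ⟨p * (leviEmbeddingP F c (leviProjection F c p))⁻¹, (MonoidHom.mem_ker).2 ?_, ?_⟩
    · rw [map_mul, map_inv, leviProjection_leviEmbeddingP_apply, mul_inv_cancel]
    · simp only [Subgroup.coe_subtype, Subgroup.coe_mul, Subgroup.coe_inv, coe_leviEmbeddingP]
  have hB : (p : GL (Fin n) F) * (blockDiagonalGL F c (leviProjection F c p))⁻¹ ∈ standardParabolicGL F (id : Fin n → Fin n) :=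
    unipotentRadicalGL_le F (id : Fin n → Fin n) (unipotentRadicalGL_le_upperUnitriangular c hc hu)
  have key := f.toFun_subgroup_mul ⟨_, hB⟩ (blockDiagonalGL F c (leviProjection F c p))
  rw [Subgroup.coe_mk, inv_mul_cancel_right, hσ'U _ (unipotentRadicalGL_le_upperUnitriangular c hc hu), Module.End.one_apply] at key
  exact key

include hc hσ'U in
/-- **THE CLOSED CELL OF THE `(B, P_c)` FILTRATION.**  There is a linear map `Ψ₀ : r_c(Ind_B σ′) → Ind_{B ∩ M_c}^{M_c}(σ′ ∘ diag)` with `Ψ₀[f](m) = f(diag m)`,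
`M_c`-equivariant (`Ψ₀(m₀·x) = m₀·Ψ₀(x)`, right translations), whose kernel is exactly the subspace of classes of functions vanishing on `P_c`.  (Closed orbit of the
geometric lemma for the pair `(B, P_c)`: `r_c` of the quotient `I ∕ {f ∣ f|_P = 0} ≅ Ind_B^P σ′` is the inflated `Ind_{B_M}^{M}(σ′|)`.)
[cite: BernsteinZelevinsky1977, Thm. 5.2] [cite: Casselman1995, §6.3, Prop. 6.3.1] -/
theorem exists_closedCellMap :
    ∃ Ψ : (restrictUnipotentGL F c (smoothIndRep (standardParabolicGL F (id : Fin n → Fin n)) σ')).Coinvariants →ₗ[ℂ]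
        SmoothInd ((standardParabolicGL F (id : Fin n → Fin n)).comap (blockDiagonalGL F c))
          (σ'.comp ((blockDiagonalGL F c).subgroupComap (standardParabolicGL F (id : Fin n → Fin n)))),
      (∀ (f : SmoothInd (standardParabolicGL F (id : Fin n → Fin n)) σ') (m : Π a, GL {i : Fin n // c i = a} F),
          (Ψ (Coinvariants.mk (restrictUnipotentGL F c (smoothIndRep (standardParabolicGL F (id : Fin n → Fin n)) σ')) f)).toFun m =
            f.toFun (blockDiagonalGL F c m)) ∧
      (∀ (m₀ : Π a, GL {i : Fin n // c i = a} F) (x : (restrictUnipotentGL F c (smoothIndRep (standardParabolicGL F (id : Fin n → Fin n)) σ')).Coinvariants),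
          Ψ (jacquetGL F c (smoothIndRep (standardParabolicGL F (id : Fin n → Fin n)) σ') m₀ x) =
            smoothIndRep ((standardParabolicGL F (id : Fin n → Fin n)).comap (blockDiagonalGL F c))
              (σ'.comp ((blockDiagonalGL F c).subgroupComap (standardParabolicGL F (id : Fin n → Fin n)))) m₀ (Ψ x)) ∧
      (∀ x : (restrictUnipotentGL F c (smoothIndRep (standardParabolicGL F (id : Fin n → Fin n)) σ')).Coinvariants,
          Ψ x = 0 ↔ ∃ f ∈ vanishingOn (standardParabolicGL F (id : Fin n → Fin n)) σ' (standardParabolicGL F c : Set (GL (Fin n) F)),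
            Coinvariants.mk (restrictUnipotentGL F c (smoothIndRep (standardParabolicGL F (id : Fin n → Fin n)) σ')) f = x) := by
  haveI : IsTopologicalRing F := inferInstance
  -- the restriction map on the level of functions
  let Φ : SmoothInd (standardParabolicGL F (id : Fin n → Fin n)) σ' →ₗ[ℂ]
      SmoothInd ((standardParabolicGL F (id : Fin n → Fin n)).comap (blockDiagonalGL F c))
        (σ'.comp ((blockDiagonalGL F c).subgroupComap (standardParabolicGL F (id : Fin n → Fin n)))) :=
    { toFun := fun f => by
        refine (⟨⟨fun m => f.toFun (blockDiagonalGL F c m), ?_⟩, ?_⟩ :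
          ↥(smoothInd ((standardParabolicGL F (id : Fin n → Fin n)).comap (blockDiagonalGL F c))
            (σ'.comp ((blockDiagonalGL F c).subgroupComap (standardParabolicGL F (id : Fin n → Fin n))))).toSubmodule)
        · rw [mem_indFun_iff]
          intro b m
          rw [map_mul]
          exact f.toFun_subgroup_mul ⟨blockDiagonalGL F c (b : Π a, GL {i : Fin n // c i = a} F), b.2⟩ (blockDiagonalGL F c m)
        · refine (indFun ((standardParabolicGL F (id : Fin n → Fin n)).comap (blockDiagonalGL F c))
              (σ'.comp ((blockDiagonalGL F c).subgroupComap (standardParabolicGL F (id : Fin n → Fin n))))).isSmoothVector_of_le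
            (K := ((smoothIndRep (standardParabolicGL F (id : Fin n → Fin n)) σ').stabilizerSubgroup f).comap (blockDiagonalGL F c))
            ((isSmooth_smoothInd (standardParabolicGL F (id : Fin n → Fin n)) σ' f).preimage (continuous_blockDiagonalGL F c)) fun u hu => ?_
          rw [mem_stabilizerSubgroup]
          refine Subtype.ext (funext fun m => ?_)
          rw [indFun_apply_apply]
          change f.toFun (blockDiagonalGL F c (m * u)) = f.toFun (blockDiagonalGL F c m)
          have hu' : blockDiagonalGL F c u ∈ (smoothIndRep (standardParabolicGL F (id : Fin n → Fin n)) σ').stabilizerSubgroup f := Subgroup.mem_comap.1 hu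
          rw [mem_stabilizerSubgroup] at hu'
          have := congrArg (fun φ : SmoothInd (standardParabolicGL F (id : Fin n → Fin n)) σ' => φ.toFun (blockDiagonalGL F c m)) hu'
          simpa only [toFun_smoothIndRep_apply, map_mul] using this
      map_add' := fun f g => SmoothInd.ext (funext fun m => rfl)
      map_smul' := fun a f => SmoothInd.ext (funext fun m => rfl) }
  have hΦ : ∀ f m, (Φ f).toFun m = f.toFun (blockDiagonalGL F c m) := fun f m => rfl
  -- `Φ` kills `u·f - f`, `u ∈ U_c`: `(u·f)(diag m) = f(diag m · u) = f((diag m · u · diag m⁻¹) · diag m) = f(diag m)`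
  have hΦU : ∀ u : ↥(unipotentRadicalP F c), Φ ∘ₗ (restrictUnipotentGL F c (smoothIndRep (standardParabolicGL F (id : Fin n → Fin n)) σ')) u = Φ := by
    intro u
    refine LinearMap.ext fun f => SmoothInd.ext (funext fun m => ?_)
    rw [LinearMap.comp_apply, hΦ, hΦ]
    change (smoothIndRep (standardParabolicGL F (id : Fin n → Fin n)) σ' ((u : ↥(standardParabolicGL F c)) : GL (Fin n) F) f).toFun (blockDiagonalGL F c m) = _
    rw [toFun_smoothIndRep_apply]
    have hu : ((u : ↥(standardParabolicGL F c)) : GL (Fin n) F) ∈ unipotentRadicalGL F c := ⟨u, u.2, rfl⟩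
    have hconj : blockDiagonalGL F c m * ((u : ↥(standardParabolicGL F c)) : GL (Fin n) F) * (blockDiagonalGL F c m)⁻¹ ∈ unipotentRadicalGL F c := by
      refine ⟨leviEmbeddingP F c m * u * (leviEmbeddingP F c m)⁻¹, (MonoidHom.mem_ker).2 ?_, ?_⟩
      · rw [map_mul, map_mul, map_inv, (MonoidHom.mem_ker).1 u.2, mul_one, mul_inv_cancel]
      · simp only [Subgroup.coe_subtype, Subgroup.coe_mul, Subgroup.coe_inv, coe_leviEmbeddingP]
    have key := f.toFun_subgroup_mul ⟨_, unipotentRadicalGL_le F (id : Fin n → Fin n) (unipotentRadicalGL_le_upperUnitriangular c hc hconj)⟩ (blockDiagonalGL F c m)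
    rw [Subgroup.coe_mk, inv_mul_cancel_right, hσ'U _ (unipotentRadicalGL_le_upperUnitriangular c hc hconj), Module.End.one_apply] at key
    exact key
  refine ⟨Coinvariants.lift _ Φ hΦU, fun f m => by rw [Coinvariants.lift_mk]; exact hΦ f m, fun m₀ x => ?_, fun x => ?_⟩
  · -- equivariance
    obtain ⟨f, rfl⟩ := Coinvariants.mk_surjective _ x
    rw [jacquetGL_mk, Coinvariants.lift_mk, Coinvariants.lift_mk]
    refine SmoothInd.ext (funext fun m => ?_)
    rw [hΦ, toFun_smoothIndRep_apply, toFun_smoothIndRep_apply, hΦ, map_mul]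
  · -- kernel
    constructor
    · intro hx
      obtain ⟨f, rfl⟩ := Coinvariants.mk_surjective _ x
      rw [Coinvariants.lift_mk] at hx
      refine ⟨f, fun p hp => ?_, rfl⟩
      rw [toFun_parabolic_eq_toFun_blockDiagonalGL c σ' hc hσ'U f ⟨p, hp⟩, ← hΦ, hx]
      rfl
    · rintro ⟨f, hf, rfl⟩
      rw [Coinvariants.lift_mk]
      exact SmoothInd.ext (funext fun m => hf _ (blockDiagonalGL_mem c m))

end ClosedCell

/-! ## §3 The inducing character of a principal series is trivial on `U`; the two right `P_{(2,1)}`-stable closed sets of `GL₃` -/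

section InducingChar

/-- **`σ′ = (χ ∘ levi)·δ_B^{1/2}` is trivial on `U_n`** (`levi u = 1`, ★ `rootDeltaChar_eq_one_of_mem_unipotentRadicalP`): the hypothesis `hσ'U` of §2 for the inducing
character of the principal series ★ `parabolicIndGL F id (𝟙.twist χ)`, any `n`, any `χ` (no continuity needed). [cite: BernsteinZelevinsky1977, 1.8, §2.3] -/
theorem inducingChar_eq_one_of_mem_upperUnitriangular (χ : (Π a : Fin n, GL {i : Fin n // (id : Fin n → Fin n) i = a} F) →* ℂˣ)
    (u : GL (Fin n) F) (hu : u ∈ upperUnitriangular (Fin n) F) :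
    Representation.twist (((Representation.trivial ℂ (Π a : Fin n, GL {i : Fin n // (id : Fin n → Fin n) i = a} F) ℂ).twist χ).comp
        (leviProjection F (id : Fin n → Fin n))) (rootDeltaChar (standardParabolicGL F (id : Fin n → Fin n)))
        ⟨u, unipotentRadicalGL_le F (id : Fin n → Fin n) hu⟩ = 1 := by
  haveI : IsTopologicalRing F := inferInstance
  have hker : (⟨u, unipotentRadicalGL_le F (id : Fin n → Fin n) hu⟩ : ↥(standardParabolicGL F (id : Fin n → Fin n))) ∈ unipotentRadicalP F (id : Fin n → Fin n) := by
    rw [← unipotentRadicalGL_subgroupOf, Subgroup.mem_subgroupOf]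
    exact hu
  refine LinearMap.ext fun z => ?_
  rw [Representation.twist_apply, MonoidHom.coe_comp, Function.comp_apply, (MonoidHom.mem_ker).1 hker, map_one,
    rootDeltaChar_eq_one_of_mem_unipotentRadicalP (F := F) (c := (id : Fin n → Fin n)) hker, Units.val_one, one_smul]

end InducingChar

section GLThree

omit [ValuativeRel F] [TopologicalSpace F] [IsNonarchimedeanLocalField F]

/-- `P_{(2,1)}` is right `P_{(2,1)}`-stable (the closed cell `C₀ = B·P = P`). [folklore] -/
theorem parabolic_mul_mem {α' : Type*} [LinearOrder α'] (c' : Fin n → α') (z : GL (Fin n) F) (hz : z ∈ (standardParabolicGL F c' : Set (GL (Fin n) F)))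
    (p : GL (Fin n) F) (hp : p ∈ standardParabolicGL F c') : z * p ∈ (standardParabolicGL F c' : Set (GL (Fin n) F)) :=
  (standardParabolicGL F c').mul_mem hz hp

/-- **The closed set `Z = C₀ ∪ C₁ = {g ∣ g₁₀ g₂₁ = g₁₁ g₂₀}`** (the planes `⟨g e₀, g e₁⟩` containing `e₀`; complement of the open `(B, P_{(2,1)})`-cell) **is right
`P_{(2,1)}`-stable**: the `{1,2} × {0,1}` minor of `g·p` is the minor of `g` times `det` of the `GL₂`-block of `p`. [cite: BernsteinZelevinsky1977, Thm. 5.2] -/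
theorem minor_mul_eq_zero_of_mem_parabolic_twoOne (z : GL (Fin 3) F)
    (hz : z ∈ {g : GL (Fin 3) F | (g : Matrix (Fin 3) (Fin 3) F) 1 0 * (g : Matrix (Fin 3) (Fin 3) F) 2 1 - (g : Matrix (Fin 3) (Fin 3) F) 1 1 * (g : Matrix (Fin 3) (Fin 3) F) 2 0 = 0})
    (p : GL (Fin 3) F) (hp : p ∈ standardParabolicGL F (![0, 0, 1] : Fin 3 → Fin 2)) :
    z * p ∈ {g : GL (Fin 3) F | (g : Matrix (Fin 3) (Fin 3) F) 1 0 * (g : Matrix (Fin 3) (Fin 3) F) 2 1 - (g : Matrix (Fin 3) (Fin 3) F) 1 1 * (g : Matrix (Fin 3) (Fin 3) F) 2 0 = 0} := by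
  rw [K2E3GL3MaximalParabolicRelabel.mem_standardParabolicGL_iff_entry] at hp
  obtain ⟨h20, h21⟩ := hp
  have hz' : (z : Matrix (Fin 3) (Fin 3) F) 1 0 * (z : Matrix (Fin 3) (Fin 3) F) 2 1 - (z : Matrix (Fin 3) (Fin 3) F) 1 1 * (z : Matrix (Fin 3) (Fin 3) F) 2 0 = 0 := hz
  show ((z * p : GL (Fin 3) F) : Matrix (Fin 3) (Fin 3) F) 1 0 * ((z * p : GL (Fin 3) F) : Matrix (Fin 3) (Fin 3) F) 2 1 -
      ((z * p : GL (Fin 3) F) : Matrix (Fin 3) (Fin 3) F) 1 1 * ((z * p : GL (Fin 3) F) : Matrix (Fin 3) (Fin 3) F) 2 0 = 0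
  have key : ((z * p : GL (Fin 3) F) : Matrix (Fin 3) (Fin 3) F) 1 0 * ((z * p : GL (Fin 3) F) : Matrix (Fin 3) (Fin 3) F) 2 1 -
      ((z * p : GL (Fin 3) F) : Matrix (Fin 3) (Fin 3) F) 1 1 * ((z * p : GL (Fin 3) F) : Matrix (Fin 3) (Fin 3) F) 2 0 =
      ((z : Matrix (Fin 3) (Fin 3) F) 1 0 * (z : Matrix (Fin 3) (Fin 3) F) 2 1 - (z : Matrix (Fin 3) (Fin 3) F) 1 1 * (z : Matrix (Fin 3) (Fin 3) F) 2 0) *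
        ((p : Matrix (Fin 3) (Fin 3) F) 0 0 * (p : Matrix (Fin 3) (Fin 3) F) 1 1 - (p : Matrix (Fin 3) (Fin 3) F) 0 1 * (p : Matrix (Fin 3) (Fin 3) F) 1 0) := by
    simp only [Units.val_mul, Matrix.mul_apply, Fin.sum_univ_three, h20, h21]
    ring
  rw [key, hz', zero_mul]

end GLThree

end Summit.HodgeConjecture.HodgeConjecture.Cruxes.H413.K2E3GL3BorelInducedJacquetQFiltration

end
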